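import Literature.Geometry.Symplectic.JHolomorphicChartLocalisation

/-!
# Compact-open convergence read uniformly in a chart
(registered helper `helper_chartUniformOfCompactOpen` of line `cross-cap-laurent`, crux
`GromovRecognitionRelEnd`, item stmt-SmoothPoincare4-11009; it feeds the manifold Weierstrass step
toward the child stub `stub_uniformLimitIsJSphere` of item stmt-SmoothPoincare4-16777)

Setting: `X` a Hausdorff second-countable smooth `4`-manifold (charts in `EuclideanSpace ℝ (Fin 4)`),
continuous maps `us k, u : ℂ → X` (`k : ℕ`), a point `x₀ : X` and a compact `K ⊆ ℂ` that `u` maps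
into the domain of the chart at `x₀`.  Hypothesis: `us k → u` in the compact-open topology, stated in
raw form (for every compact `K'` and every open `O ⊇ u '' K'`, eventually `us k '' K' ⊆ O`).

Claim (`helper_chartUniformOfCompactOpen`): (a) the chart expressions
`extChartAt (𝓡 4) x₀ ∘ us k → extChartAt (𝓡 4) x₀ ∘ u` uniformly on `K` (values in the normed space
`EuclideanSpace ℝ (Fin 4)`), and (b) eventually `us k` maps `K` into the chart domain.

Proof.  A locally compact (charted over `ℝ⁴`) Hausdorff second-countable space is metrizable
(Urysohn, `TopologicalSpace.metrizableSpace_of_t3_secondCountable`); fix a compatible metric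
(`TopologicalSpace.metrizableSpaceMetric`).  Bundling `us k`, `u` as elements of `C(ℂ, X)`, the raw
hypothesis is convergence in the compact-open topology (`ContinuousMap.tendsto_nhds_compactOpen`),
which is uniform convergence on compacta (`ContinuousMap.tendsto_iff_forall_isCompact_tendstoUniformlyOn`),
in particular uniform convergence on `K` in the metric of `X`.  The tree lemma
`Literature.Geometry.Symplectic.ChartLocalisation.tendstoUniformlyOn_chart_of_isEmbedding` (with the
identity embedding of `X`, `φ` the extended chart, continuous on the open chart domain `S`, and the
compact `u '' K ⊆ S`) transports this through the chart: eventually the `us k` map `K` into `S`, and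
`φ ∘ us k → φ ∘ u` uniformly on `K`.

References: J. L. Kelley, *General Topology* (1955), Ch. 7, Thm. 11 (compact-open = compact
convergence on compacta for continuous maps into a uniform space); Urysohn metrization.
No new definitions, notation or instances.
-/

open scoped Manifold ContDiff Topology
open Set Function Filter

-- the prescribed namespace `Summit.<P>.<Sub>.…` duplicates `SmoothPoincare4` (P = Sub)
set_option linter.dupNamespace false

namespace Summit.SmoothPoincare4.SmoothPoincare4.Theorems.GromovRecognitionRelEnd.CrossCapLaurent

/-- **Compact-open convergence read uniformly in a chart.**  Let `X` be a Hausdorff second-countable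
smooth `4`-manifold, `us k, u : ℂ → X` continuous, `K ⊆ ℂ` compact with `u '' K` inside the domain of
the chart at `x₀`, and suppose `us k → u` in the compact-open sense (for every compact `K'` and open
`O ⊇ u '' K'`, eventually `us k '' K' ⊆ O`).  Then the chart expressions
`extChartAt (𝓡 4) x₀ ∘ us k` converge to `extChartAt (𝓡 4) x₀ ∘ u` uniformly on `K`, and eventually
`us k '' K` lies in the chart domain.  (Metrize `X` by Urysohn; compact-open convergence of the
bundled maps is uniform convergence on compacta, `ContinuousMap.tendsto_iff_forall_isCompact_tendstoUniformlyOn`;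
then `ChartLocalisation.tendstoUniformlyOn_chart_of_isEmbedding` with the identity embedding.)
[folklore; Kelley 1955, Ch. 7 Thm. 11] -/
theorem helper_chartUniformOfCompactOpen : ∀ (X : Type) [TopologicalSpace X] [T2Space X] [SecondCountableTopology X] [ChartedSpace (EuclideanSpace ℝ (Fin 4)) X] [IsManifold (𝓡 4) ∞ X] (us : ℕ → ℂ → X) (u : ℂ → X) (x₀ : X) (K : Set ℂ), (∀ k, Continuous (us k)) → Continuous u → IsCompact K → Set.MapsTo u K (chartAt (EuclideanSpace ℝ (Fin 4)) x₀).source → (∀ K' : Set ℂ, IsCompact K' → ∀ O : Set X, IsOpen O → Set.MapsTo u K' O → ∀ᶠ k in Filter.atTop, Set.MapsTo (us k) K' O) → TendstoUniformlyOn (fun k z => extChartAt (𝓡 4) x₀ (us k z)) (fun z => extChartAt (𝓡 4) x₀ (u z)) Filter.atTop K ∧ ∀ᶠ k in Filter.atTop, Set.MapsTo (us k) K (chartAt (EuclideanSpace ℝ (Fin 4)) x₀).source := by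
  intro X _ _ _ _ _ us u x₀ K hcont hu hK hKsrc hco
  -- `X` is locally compact, Hausdorff and second countable, hence metrizable: fix a metric
  haveI := ChartedSpace.locallyCompactSpace (EuclideanSpace ℝ (Fin 4)) X
  haveI : TopologicalSpace.MetrizableSpace X :=
    TopologicalSpace.metrizableSpace_of_t3_secondCountable X
  letI : MetricSpace X := TopologicalSpace.metrizableSpaceMetric X
  -- the raw hypothesis is compact-open convergence of the bundled continuous maps
  have hF : Tendsto (fun k => (⟨us k, hcont k⟩ : C(ℂ, X))) atTop (𝓝 (⟨u, hu⟩ : C(ℂ, X))) :=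
    ContinuousMap.tendsto_nhds_compactOpen.2 hco
  -- hence uniform convergence on the compact `K` in the metric of `X`
  have hunif : TendstoUniformlyOn (fun k z => us k z) u atTop K :=
    (ContinuousMap.tendsto_iff_forall_isCompact_tendstoUniformlyOn.1 hF) K hK
  -- transport through the chart (identity embedding of `X`, `φ = extChartAt (𝓡 4) x₀`)
  have h := Literature.Geometry.Symplectic.ChartLocalisation.tendstoUniformlyOn_chart_of_isEmbedding
    (ι := (id : X → X)) Topology.IsEmbedding.id (φ := extChartAt (𝓡 4) x₀)
    (chartAt (EuclideanSpace ℝ (Fin 4)) x₀).open_source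
    (by rw [← extChartAt_source (I := 𝓡 4)]; exact continuousOn_extChartAt x₀)
    (hK.image hu) hKsrc.image_subset (fun z hz => mem_image_of_mem u hz) hunif
  exact ⟨h.1, h.2.mono fun k hk z hz => hk z hz⟩

end Summit.SmoothPoincare4.SmoothPoincare4.Theorems.GromovRecognitionRelEnd.CrossCapLaurent
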